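import Summits.BirchSwinnertonDyer.BirchSwinnertonDyer.Theorems.PrintX10bHowardContainmentPinnedOfThreeLeavesIntended
import Summits.BirchSwinnertonDyer.BirchSwinnertonDyer.Theorems.PoitouTateSelmerStructureDualityConjHolds
import Literature.NumberTheory.GaloisCohomology.Howard2004.EngineDecompositionsOfSkewPairingIntendedProofs
import HarnessLib

/-!
# DISPLAY-PROP141″-X10b — row 10's A-side and displays with Howard's Thm. 1.6.1 REPLACED by Howard's Prop. 1.4.1 / Thm. 1.4.2 PRINT-AS-INTENDED
# (Flach 1990; cite-only leaf C45.1″ `Howard2004.prop141_casselsTate_skewPairing_atLevel_printIntended`, REF-177):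
# `howardContainmentLightFrameX10bPinned_of_prop141Intended_kolyvaginSystem_cgs`, `wallCornerX10b_of_sixLeaves_prop141Intended`, `bsdpOnClassX10b_of_sixLeaves_prop141Intended`

Cell `pub/bsd-print-x9`, seat `bsd-line-x9-p1` LEAD g10; pen plan g15 GO 2026-08-29T10:18:59Z; LEAD g13 GO 10:19:25Z. `--supports`
stmt-BirchSwinnertonDyer-22642 (helper). THEOREMS ONLY. The X10b twin of `PrintX9HowardContainmentPinnedOfFlachLeafIntended` (independent of it): G3's
`PrintX10bOfKSLeafIntended` theorems (T-161′-X10b) at the engine's F-161′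
(`HowardThm161PrintIntended.thm161_printIntended_of_prop141_printIntended` = w7 g12's `DVRSetting.thm161_printIntended_of_prop141_printIntended` with the tree's Poitou–Tate theorem).
* **`howardContainmentLightFrameX10bPinned_of_prop141Intended_kolyvaginSystem_cgs :
  prop141_casselsTate_skewPairing_atLevel_printIntended → CGLSHeegnerKolyvaginSystem → CGSHowardDivisibilityPLocalized → HowardContainmentLightFrameX10bPinned`** (27274's decl);
* **`wallCornerX10b_of_sixLeaves_prop141Intended` / `bsdpOnClassX10b_of_sixLeaves_prop141Intended (h141 hK hCGS hPT hHP hP)`** — row 10's corner and leaf from SIX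
  cite-only binders, the Howard leaf being Prop. 1.4.1 (Flach).
HONEST FRAMING: CONDITIONAL on the leaves named; no item is closed by this file; no route verb is implied. «beyond-print theorem»: no.
No summit statement is proved; BSD is NOT proved by any of this.

References: [Howard2004HeegnerKolyvagin] Prop. 1.4.1, Thm. 1.4.2, Thm. 1.6.1; [Flach1990]; [CastellaGrossiLeeSkinner2022] Thm. 4.1.1, Rem. 4.1.4;
[CastellaGrossiSkinner2025] Thm. 6.5.2; [MilneADT2006] I Thm. 4.10.
-/

set_option linter.dupNamespace false
set_option autoImplicit false

noncomputable section

open Literature.NumberTheory.GaloisCohomology Literature.NumberTheory.GaloisCohomology.Howard2004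
open Summit.BirchSwinnertonDyer.BirchSwinnertonDyer.Theses.PrintX10b
  (CGLSHeegnerKolyvaginSystem CGSHowardDivisibilityPLocalized HowardContainmentLightFrameX10bPinned
    PinnedTransferPrintFacts HeegnerPrintFactsX10b PrintFactsX10b)
open Summit.BirchSwinnertonDyer.BirchSwinnertonDyer.Theorems

namespace Summit.BirchSwinnertonDyer.BirchSwinnertonDyer.Theorems.PrintX10bOfFlachLeafIntended

/-- **`HowardContainmentLightFrameX10bPinned` (stmt-BirchSwinnertonDyer-27274) from Howard Prop. 1.4.1 print-as-intended (Flach, C45.1″), F-411, CGS 6.5.2** —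
G3's `howardContainmentLightFrameX10bPinned_of_howardIntended_kolyvaginSystem_cgs` at the engine's F-161′. CONDITIONAL on the three leaves.
[cite: Howard2004HeegnerKolyvagin, Prop. 1.4.1, Thm. 1.4.2, Thm. 1.6.1] [cite: CastellaGrossiLeeSkinner2022, Thm. 4.1.1] [cite: CastellaGrossiSkinner2025, Thm. 6.5.2] -/
theorem howardContainmentLightFrameX10bPinned_of_prop141Intended_kolyvaginSystem_cgs :
    prop141_casselsTate_skewPairing_atLevel_printIntended → CGLSHeegnerKolyvaginSystem → CGSHowardDivisibilityPLocalized →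
      HowardContainmentLightFrameX10bPinned :=
  fun h141 ↦ PrintX10bOfKSLeafIntended.howardContainmentLightFrameX10bPinned_of_howardIntended_kolyvaginSystem_cgs
    (DVRSetting.thm161_printIntended_of_prop141_printIntended h141 fun K _ _ =>
      InputsPoitouTateSelmer.poitouTate_selmerStructure_duality_conj_holds K)

/-- **DISPLAY — the W-ALL row-10 corner `WAllCornerX10b` from SIX cite-only binders, the Howard leaf being Prop. 1.4.1 (Flach)**:
C45.1″, F-411, CGS 6.5.2, `PinnedTransferPrintFacts`, `HeegnerPrintFactsX10b`, `PrintFactsX10b` — G3's `wallCornerX10b_of_sixLeaves_intended` at the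
engine's F-161′. CONDITIONAL; a display, not a closure. [cite: Howard2004HeegnerKolyvagin, Prop. 1.4.1, Thm. 1.6.1]
[cite: CastellaGrossiLeeSkinner2022, Thm. 4.1.1] [cite: CastellaGrossiSkinner2025, Thm. 6.5.2] -/
theorem wallCornerX10b_of_sixLeaves_prop141Intended
    (h141 : prop141_casselsTate_skewPairing_atLevel_printIntended) (hK : CGLSHeegnerKolyvaginSystem) (hCGS : CGSHowardDivisibilityPLocalized)
    (hPT : PinnedTransferPrintFacts) (hHP : HeegnerPrintFactsX10b) (hP : PrintFactsX10b) :
    Summit.BirchSwinnertonDyer.WAllCornerX10b :=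
  PrintX10bOfKSLeafIntended.wallCornerX10b_of_sixLeaves_intended (DVRSetting.thm161_printIntended_of_prop141_printIntended h141 fun K _ _ =>
      InputsPoitouTateSelmer.poitouTate_selmerStructure_duality_conj_holds K) hK hCGS hPT hHP hP

/-- **DISPLAY — the partition leaf `X10.BSDpOnClassX10b` from the same SIX cite-only binders, Howard leaf = Prop. 1.4.1 (Flach).**
[cite: Howard2004HeegnerKolyvagin, Prop. 1.4.1, Thm. 1.6.1] [cite: CastellaGrossiLeeSkinner2022, Thm. 4.1.1] [cite: CastellaGrossiSkinner2025, Thm. 6.5.2] -/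
theorem bsdpOnClassX10b_of_sixLeaves_prop141Intended
    (h141 : prop141_casselsTate_skewPairing_atLevel_printIntended) (hK : CGLSHeegnerKolyvaginSystem) (hCGS : CGSHowardDivisibilityPLocalized)
    (hPT : PinnedTransferPrintFacts) (hHP : HeegnerPrintFactsX10b) (hP : PrintFactsX10b) :
    Summit.BirchSwinnertonDyer.Rank1Residual.X10.BSDpOnClassX10b :=
  PrintX10bOfKSLeafIntended.bsdpOnClassX10b_of_sixLeaves_intended (DVRSetting.thm161_printIntended_of_prop141_printIntended h141 fun K _ _ =>
      InputsPoitouTateSelmer.poitouTate_selmerStructure_duality_conj_holds K) hK hCGS hPT hHP hP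

end Summit.BirchSwinnertonDyer.BirchSwinnertonDyer.Theorems.PrintX10bOfFlachLeafIntended

end
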